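import Mathlib
import HarnessLib
import Summits.NavierStokesRegularity.NavierStokesRegularity.Theorems.HalfSpaceWindowDoorCirculationCarryingRigidityMovingBarrier
import Summits.NavierStokesRegularity.NavierStokesRegularity.Theorems.HalfSpaceWindowDoorCirculationCarryingRigidityMovingConfinement
import Summits.NavierStokesRegularity.NavierStokesRegularity.Theorems.HalfSpaceWindowDoorCirculationCarryingRigidityRotate

/-!
# Route `HalfSpaceWindowDoor`, crux `CirculationCarryingRigidity` (stmt-NavierStokesRegularity-25311) — line `eddy_covariance`, MOVING FRAME:
# W6 = `HemisphereLiouvilleE3` ⟸ the quiet eddy bound on record far circles about ONE SIMILARITY-FIXED axis `x_h = √(−t)·y₀`, BY NAME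

LEAD ns-hsw-p1 g10, `--supports 25311 --as helper`; card `Cruxes/…/Lines/eddy_covariance.md`.  `…QuietLiouville` with the fixed axis
replaced by the moving one: for `W(t,x) = v(t, x + √(−t)y₀)` (circles centred at `x_h = √(−t)y₀`, i.e. at the FIXED point `y₀` of similarity
variables `x/√(−t)`), the sweeping conclusion `circ_le_sSup_of_moving` (from `…MovingBarrier.circ_le_of_moving_aux`), parabolic confinement
about the moving axis (`…MovingConfinement`) and POLOIDALITY of `v` (`inner_curl_e3_eq_zero_of_movingEddyBound`) from the EDDY BOUND
`ℛ_W ≤ (B/√(−t))(∮ω₃ dl + |∮ω_r dl|)` at times `t ≤ σ₀` on RECORD far circles about the moving axis that are QUIET and GROWING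
(`R₁ = 4(B + ‖y₀‖/2 + C) + R₀ + 1 + 8πC/η₀`: the moving flux costs `‖y₀‖/2` of drift).  By name: `hemisphereLiouvilleE3_of_movingEddyBound` —
W6 holds as soon as every closed-hemisphere door-class profile obeys the quiet eddy bound about SOME similarity-fixed vertical axis `y₀` in SOME
epoch; `circulationCarryingRigidity_of_movingEddyBound`; enemy form `enemy_moving_fails` (the bound fails about EVERY similarity-fixed axis).
WHAT THIS IS NOT: not about NS regularity (Clay A); HYPOTHETICAL blow-up profiles; the item stays OPEN at its research stub; nothing is closed here.
-/

noncomputable section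

-- the summit and its single sub-problem share the name (CONVENTIONS §1), as in every Theorems file
set_option linter.dupNamespace false

namespace Summit.NavierStokesRegularity.NavierStokesRegularity.Theorems.HalfSpaceWindowDoorCirculationCarryingRigidityMovingLiouville

open MeasureTheory Set Function Filter Topology InnerProductSpace
open scoped RealInnerProductSpace InnerProductSpace
open Literature.Analysis Literature.Analysis.UnboundedOperators
open Literature.Analysis.FluidPDE hiding eR
open Summit.NavierStokesRegularity.NavierStokesRegularity.Theses.HalfSpaceWindowDoor (CirculationCarryingRigidity)
open Summit.NavierStokesRegularity.NavierStokesRegularity.Theorems.HalfSpaceWindowDoorCirculationCarryingRigidityDefs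
  (InDoorClass SignE3 e3 HemisphereLiouvilleE3)
open Summit.NavierStokesRegularity.NavierStokesRegularity.Theorems.AxisTwistDoorAveragedConeLiouvilleDefs
  (cylPt eR circ vortCirc radVortCirc meanR meanZ remainder)
open Summit.NavierStokesRegularity.NavierStokesRegularity.Theorems.HalfSpaceWindowDoorCirculationCarryingRigidityMovingFrame
  (tube_bddAbove_moving)
open Summit.NavierStokesRegularity.NavierStokesRegularity.Theorems.HalfSpaceWindowDoorCirculationCarryingRigidityMovingBarrier
  (circ_le_of_moving_aux)
open Summit.NavierStokesRegularity.NavierStokesRegularity.Theorems.HalfSpaceWindowDoorCirculationCarryingRigidityMovingConfinement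
  (inner_curl_e3_eq_zero_of_confined_moving)
open Summit.NavierStokesRegularity.NavierStokesRegularity.Theorems.HalfSpaceWindowDoorCirculationCarryingRigidityRotate (stub_rotate)

variable {C : ℝ} {v : ℝ → EuclideanSpace ℝ (Fin 3) → EuclideanSpace ℝ (Fin 3)}

/-! ### The sweeping lemma about a moving axis -/

/-- **THE SWEEPING LEMMA about a moving axis**: `Γ_W(r,z,s) ≤ sup { Γ_W(R₁√(−s'), z', s') : s' ≤ s₁ }` for all `r ≥ 0`, `s ≤ s₁ < 0`,
`R₁ = 4(B + ‖y₀‖/2 + C) + R₀ + 1 + 8πC/η₀`, from the EDDY bound on RECORD far circles about the axis `x_h = √(−t)y₀` that are QUIET and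
GROWING, at times `≤ s₁` only (the barrier terms of `circ_le_of_moving_aux` vanish as `s₀ → −∞`). -/
theorem circ_le_sSup_of_moving (hv : InDoorClass C v) (hsign : SignE3 v) (y₀ : EuclideanSpace ℝ (Fin 3)) {B : ℝ} (hB0 : 0 ≤ B)
    {R₀ : ℝ} (hR₀ : 0 ≤ R₀) {s₁ : ℝ} (hs₁ : s₁ < 0) {η₀ : ℝ} (hη : 0 < η₀)
    (hed : ∀ t : ℝ, t ≤ s₁ → ∀ r : ℝ, R₀ * Real.sqrt (-t) ≤ r → ∀ z : ℝ,
      (∀ s' : ℝ, s' ≤ t → ∀ z' : ℝ,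
        circ (fun τ x => v τ (x + Real.sqrt (-τ) • y₀)) ((4 * (B + ‖y₀‖ / 2 + C) + R₀ + 1 + 8 * Real.pi * C / η₀) * Real.sqrt (-s')) z' s' < circ (fun τ x => v τ (x + Real.sqrt (-τ) • y₀)) r z t) →
      (-t) * vortCirc (fun τ x => v τ (x + Real.sqrt (-τ) • y₀)) r z t ≤ η₀ * r → (-t) * |radVortCirc (fun τ x => v τ (x + Real.sqrt (-τ) • y₀)) r z t| ≤ η₀ * r →
      0 < deriv (fun σ => circ (fun τ x => v τ (x + Real.sqrt (-τ) • y₀)) r z σ) t →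
      remainder (fun τ x => v τ (x + Real.sqrt (-τ) • y₀)) r z t ≤ B / Real.sqrt (-t) * (vortCirc (fun τ x => v τ (x + Real.sqrt (-τ) • y₀)) r z t + |radVortCirc (fun τ x => v τ (x + Real.sqrt (-τ) • y₀)) r z t|))
    {s : ℝ} (hs : s ≤ s₁) {r : ℝ} (hr : 0 ≤ r) (z : ℝ) :
    circ (fun τ x => v τ (x + Real.sqrt (-τ) • y₀)) r z s ≤ sSup {m : ℝ | ∃ s' : ℝ, s' ≤ s₁ ∧ ∃ z' : ℝ, m = circ (fun τ x => v τ (x + Real.sqrt (-τ) • y₀)) ((4 * (B + ‖y₀‖ / 2 + C) + R₀ + 1 + 8 * Real.pi * C / η₀) * Real.sqrt (-s')) z' s'} := by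
  set μ := sSup {m : ℝ | ∃ s' : ℝ, s' ≤ s₁ ∧ ∃ z' : ℝ, m = circ (fun τ x => v τ (x + Real.sqrt (-τ) • y₀)) ((4 * (B + ‖y₀‖ / 2 + C) + R₀ + 1 + 8 * Real.pi * C / η₀) * Real.sqrt (-s')) z' s'}
  have hC : 0 ≤ C := HalfSpaceWindowDoorCirculationCarryingRigidityConeFluxSubsolution.typeI_const_nonneg hv
  have hs0 : s < 0 := lt_of_le_of_lt hs hs₁
  have hsqs : 0 < Real.sqrt (-s) := Real.sqrt_pos.2 (neg_pos.2 hs0)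
  refine le_of_forall_pos_le_add fun δ hδ => ?_
  -- `s₀` so negative that both barrier terms at time `s` are `≤ δ/2`
  set L : ℝ := η₀ / 8 * r ^ 2 / (Real.sqrt (-s) * (δ / 2)) with hL
  have hL0 : 0 ≤ L := by positivity
  set M : ℝ := (2 * Real.pi * C * r / (δ / 2)) ^ 2 / Real.sqrt (-s) with hM
  have hM0 : 0 ≤ M := by positivity
  set s₀ : ℝ := s - 1 - L ^ 2 - M ^ 2 with hs₀def
  have hs₀s : s₀ < s := by rw [hs₀def]; nlinarith [sq_nonneg L, sq_nonneg M]
  have hs₀₁ : s₀ < s₁ := lt_of_lt_of_le hs₀s hs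
  have hsq₀ : L ≤ Real.sqrt (-s₀) := by
    rw [show L = Real.sqrt (L ^ 2) from (Real.sqrt_sq hL0).symm]
    exact Real.sqrt_le_sqrt (by rw [hs₀def]; nlinarith [sq_nonneg M])
  have hsq₀M : M ≤ Real.sqrt (-s₀) := by
    rw [show M = Real.sqrt (M ^ 2) from (Real.sqrt_sq hM0).symm]
    exact Real.sqrt_le_sqrt (by rw [hs₀def]; nlinarith [sq_nonneg L])
  have hsq₀pos : 0 < Real.sqrt (-s₀) := Real.sqrt_pos.2 (by linarith)
  have h := circ_le_of_moving_aux hv hsign y₀ hB0 hR₀ hs₀₁ hs₁ hη hed s ⟨hs₀s.le, hs⟩ r hr z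
  -- quadratic term `≤ δ/2`
  have hquad : η₀ / 8 * r ^ 2 / (Real.sqrt (-s) * Real.sqrt (-s₀)) ≤ δ / 2 := by
    rw [div_le_iff₀ (by positivity)]
    have h1 : η₀ / 8 * r ^ 2 = L * (Real.sqrt (-s) * (δ / 2)) := by rw [hL]; field_simp
    rw [h1]
    have := mul_le_mul_of_nonneg_left hsq₀ (by positivity : 0 ≤ Real.sqrt (-s) * (δ / 2))
    nlinarith [this]
  -- linear term `≤ δ/2`: `2πC r/√(√(−s)√(−s₀)) ≤ δ/2` iff `(2πCr/(δ/2))² ≤ √(−s)√(−s₀)`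
  have hlin : 2 * Real.pi * C * (Real.sqrt (Real.sqrt (-s) * Real.sqrt (-s₀)))⁻¹ * r ≤ δ / 2 := by
    have hg : 0 < Real.sqrt (-s) * Real.sqrt (-s₀) := mul_pos hsqs hsq₀pos
    have hG : 0 < Real.sqrt (Real.sqrt (-s) * Real.sqrt (-s₀)) := Real.sqrt_pos.2 hg
    have hM' : (2 * Real.pi * C * r / (δ / 2)) ^ 2 ≤ Real.sqrt (-s) * Real.sqrt (-s₀) := by
      have e : (2 * Real.pi * C * r / (δ / 2)) ^ 2 = M * Real.sqrt (-s) := by rw [hM]; field_simp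
      rw [e, mul_comm]
      exact mul_le_mul_of_nonneg_left hsq₀M hsqs.le
    have hroot : 2 * Real.pi * C * r / (δ / 2) ≤ Real.sqrt (Real.sqrt (-s) * Real.sqrt (-s₀)) := by
      rw [← Real.sqrt_sq (by positivity : 0 ≤ 2 * Real.pi * C * r / (δ / 2))]
      exact Real.sqrt_le_sqrt hM'
    have h2 : 2 * Real.pi * C * r ≤ δ / 2 * Real.sqrt (Real.sqrt (-s) * Real.sqrt (-s₀)) := by
      rw [div_le_iff₀ (by positivity)] at hroot
      linarith
    have e : 2 * Real.pi * C * (Real.sqrt (Real.sqrt (-s) * Real.sqrt (-s₀)))⁻¹ * r =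
        (2 * Real.pi * C * r) / Real.sqrt (Real.sqrt (-s) * Real.sqrt (-s₀)) := by
      field_simp
    rw [e, div_le_iff₀ hG]
    exact h2
  linarith

/-! ### W6 and the crux from the moving-frame eddy bound -/

/-- **W6 ⟸ THE EDDY BOUND ON RECORD FAR CIRCLES ABOUT A SIMILARITY-FIXED AXIS.**  Door class + `⟪curl v, e₃⟫ ≥ 0`; fix `y₀ ∈ ℝ³`,
`B, R₀ ≥ 0`, `η₀ > 0`, `R₁ = 4(B + ‖y₀‖/2 + C) + R₀ + 1 + 8πC/η₀` and an epoch `σ₀ < 0`; if the eddy remainder of `W(t,x) = v(t, x + √(−t)y₀)`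
obeys `ℛ_W(r,z,t) ≤ (B/√(−t))(∮ω₃ dl + |∮ω_r dl|)` for `t ≤ σ₀` on the record far circles about the moving axis that are QUIET and GROWING, then
`⟪curl v, e₃⟫ ≡ 0` on the whole slab (sweeping ⇒ confinement about the moving axis ⇒ `inner_curl_e3_eq_zero_of_confined_moving`). -/
theorem inner_curl_e3_eq_zero_of_movingEddyBound (hv : InDoorClass C v) (hsign : SignE3 v) (y₀ : EuclideanSpace ℝ (Fin 3)) {B : ℝ} (hB : 0 ≤ B)
    {R₀ : ℝ} (hR₀ : 0 ≤ R₀) {σ₀ : ℝ} (hσ₀ : σ₀ < 0) {η₀ : ℝ} (hη : 0 < η₀)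
    (hed : ∀ t : ℝ, t ≤ σ₀ → ∀ r : ℝ, R₀ * Real.sqrt (-t) ≤ r → ∀ z : ℝ,
      (∀ s' : ℝ, s' ≤ t → ∀ z' : ℝ,
        circ (fun τ x => v τ (x + Real.sqrt (-τ) • y₀)) ((4 * (B + ‖y₀‖ / 2 + C) + R₀ + 1 + 8 * Real.pi * C / η₀) * Real.sqrt (-s')) z' s' < circ (fun τ x => v τ (x + Real.sqrt (-τ) • y₀)) r z t) →
      (-t) * vortCirc (fun τ x => v τ (x + Real.sqrt (-τ) • y₀)) r z t ≤ η₀ * r → (-t) * |radVortCirc (fun τ x => v τ (x + Real.sqrt (-τ) • y₀)) r z t| ≤ η₀ * r →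
      0 < deriv (fun σ => circ (fun τ x => v τ (x + Real.sqrt (-τ) • y₀)) r z σ) t →
      remainder (fun τ x => v τ (x + Real.sqrt (-τ) • y₀)) r z t ≤ B / Real.sqrt (-t) * (vortCirc (fun τ x => v τ (x + Real.sqrt (-τ) • y₀)) r z t + |radVortCirc (fun τ x => v τ (x + Real.sqrt (-τ) • y₀)) r z t|)) :
    ∀ s < 0, ∀ y, ⟪curl (v s) y, e3⟫ = 0 := by
  have hC : 0 ≤ C := HalfSpaceWindowDoorCirculationCarryingRigidityConeFluxSubsolution.typeI_const_nonneg hv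
  set R₁ : ℝ := 4 * (B + ‖y₀‖ / 2 + C) + R₀ + 1 + 8 * Real.pi * C / η₀ with hR₁
  have hR₁0 : 0 ≤ R₁ := by positivity
  set S : Set ℝ := {m : ℝ | ∃ s' : ℝ, s' ≤ σ₀ ∧ ∃ z' : ℝ, m = circ (fun τ x => v τ (x + Real.sqrt (-τ) • y₀)) (R₁ * Real.sqrt (-s')) z' s'} with hS
  set S₀ : ℝ := sSup S with hS₀
  obtain ⟨hSbdd, -⟩ := tube_bddAbove_moving hv y₀ hR₁0 hσ₀
  have hSne : S.Nonempty := ⟨_, σ₀, le_rfl, 0, rfl⟩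
  refine inner_curl_e3_eq_zero_of_confined_moving hv hsign y₀ hR₁0 hσ₀ (S₀ := S₀) ?_ ?_
  · intro s hs r hr z
    exact circ_le_sSup_of_moving hv hsign y₀ hB hR₀ hσ₀ hη hed hs hr z
  · intro ε hε
    have hlt : S₀ - ε < S₀ := by linarith
    obtain ⟨m, ⟨s', hs', z', rfl⟩, hm⟩ := exists_lt_of_lt_csSup hSne hlt
    exact ⟨s', hs', z', hm⟩

/-- **ENEMY FORM (census reading).**  A circulation-carrying closed-hemisphere door-class profile violates the quiet eddy bound about EVERY
similarity-fixed vertical axis `y₀`: for all `B, R₀ ≥ 0`, `η₀ > 0` and every epoch `σ₀ < 0` there are a time `t ≤ σ₀` and a quiet, growing RECORD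
far circle about `x_h = √(−t)y₀` with `ℛ_W(r,z,t) > (B/√(−t))(∮ω₃ dl + |∮ω_r dl|)`. -/
theorem enemy_moving_fails (hv : InDoorClass C v) (hsign : SignE3 v) (hpos : ∃ σ < 0, ∃ y, 0 < ⟪curl (v σ) y, e3⟫)
    (y₀ : EuclideanSpace ℝ (Fin 3)) {B : ℝ} (hB : 0 ≤ B) {R₀ : ℝ} (hR₀ : 0 ≤ R₀) {σ₀ : ℝ} (hσ₀ : σ₀ < 0) {η₀ : ℝ} (hη : 0 < η₀) :
    ∃ t : ℝ, t ≤ σ₀ ∧ ∃ r : ℝ, R₀ * Real.sqrt (-t) ≤ r ∧ ∃ z : ℝ,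
      (∀ s' : ℝ, s' ≤ t → ∀ z' : ℝ,
        circ (fun τ x => v τ (x + Real.sqrt (-τ) • y₀)) ((4 * (B + ‖y₀‖ / 2 + C) + R₀ + 1 + 8 * Real.pi * C / η₀) * Real.sqrt (-s')) z' s' < circ (fun τ x => v τ (x + Real.sqrt (-τ) • y₀)) r z t) ∧
      (-t) * vortCirc (fun τ x => v τ (x + Real.sqrt (-τ) • y₀)) r z t ≤ η₀ * r ∧ (-t) * |radVortCirc (fun τ x => v τ (x + Real.sqrt (-τ) • y₀)) r z t| ≤ η₀ * r ∧
      0 < deriv (fun σ => circ (fun τ x => v τ (x + Real.sqrt (-τ) • y₀)) r z σ) t ∧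
      B / Real.sqrt (-t) * (vortCirc (fun τ x => v τ (x + Real.sqrt (-τ) • y₀)) r z t + |radVortCirc (fun τ x => v τ (x + Real.sqrt (-τ) • y₀)) r z t|) < remainder (fun τ x => v τ (x + Real.sqrt (-τ) • y₀)) r z t := by
  by_contra h
  push Not at h
  obtain ⟨σ, hσ, y, hy⟩ := hpos
  have h0 := inner_curl_e3_eq_zero_of_movingEddyBound hv hsign y₀ hB hR₀ hσ₀ hη
    (fun t ht r hr z hrec h1 h2 h3 => h t ht r hr z hrec h1 h2 h3) σ hσ y
  exact hy.ne' h0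

/-- **Crux format.**  In the situation of the crux specialised to `e = e₃` (closed hemisphere, circulation-carrying), the quiet eddy bound about
a similarity-fixed axis in one far-past epoch is contradictory — in particular the apex is not backward-singular. -/
theorem not_isBackwardSingularPoint_of_movingEddyBound (hv : InDoorClass C v) (hsign : SignE3 v)
    (hpos : ∃ σ < 0, ∃ y, 0 < ⟪curl (v σ) y, e3⟫) (y₀ : EuclideanSpace ℝ (Fin 3)) {B : ℝ} (hB : 0 ≤ B) {R₀ : ℝ} (hR₀ : 0 ≤ R₀) {σ₀ : ℝ} (hσ₀ : σ₀ < 0)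
    {η₀ : ℝ} (hη : 0 < η₀)
    (hed : ∀ t : ℝ, t ≤ σ₀ → ∀ r : ℝ, R₀ * Real.sqrt (-t) ≤ r → ∀ z : ℝ,
      (∀ s' : ℝ, s' ≤ t → ∀ z' : ℝ,
        circ (fun τ x => v τ (x + Real.sqrt (-τ) • y₀)) ((4 * (B + ‖y₀‖ / 2 + C) + R₀ + 1 + 8 * Real.pi * C / η₀) * Real.sqrt (-s')) z' s' < circ (fun τ x => v τ (x + Real.sqrt (-τ) • y₀)) r z t) →
      (-t) * vortCirc (fun τ x => v τ (x + Real.sqrt (-τ) • y₀)) r z t ≤ η₀ * r → (-t) * |radVortCirc (fun τ x => v τ (x + Real.sqrt (-τ) • y₀)) r z t| ≤ η₀ * r →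
      0 < deriv (fun σ => circ (fun τ x => v τ (x + Real.sqrt (-τ) • y₀)) r z σ) t →
      remainder (fun τ x => v τ (x + Real.sqrt (-τ) • y₀)) r z t ≤ B / Real.sqrt (-t) * (vortCirc (fun τ x => v τ (x + Real.sqrt (-τ) • y₀)) r z t + |radVortCirc (fun τ x => v τ (x + Real.sqrt (-τ) • y₀)) r z t|)) :
    ¬ IsBackwardSingularPoint v 0 := by
  intro _
  obtain ⟨t, ht, r, hr, z, hrec, h1, h2, h3, hlt⟩ := enemy_moving_fails hv hsign hpos y₀ hB hR₀ hσ₀ hη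
  exact (not_lt.2 (hed t ht r hr z hrec h1 h2 h3)) hlt

/-- **BY-NAME REDUCTION of the open stub W6, moving frame.**  If every closed-hemisphere profile of the door class obeys, about SOME
similarity-fixed vertical axis `y₀` and for SOME `B, R₀ ≥ 0`, `η₀ > 0`, SOME epoch `σ₀ < 0`, the quiet eddy bound on the growing record far
circles at the times `≤ σ₀`, then `HemisphereLiouvilleE3` holds. -/
theorem hemisphereLiouvilleE3_of_movingEddyBound
    (H : ∀ (C : ℝ) (v : ℝ → EuclideanSpace ℝ (Fin 3) → EuclideanSpace ℝ (Fin 3)), InDoorClass C v → SignE3 v →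
      ∃ y₀ : EuclideanSpace ℝ (Fin 3), ∃ B : ℝ, 0 ≤ B ∧ ∃ R₀ : ℝ, 0 ≤ R₀ ∧ ∃ σ₀ : ℝ, σ₀ < 0 ∧ ∃ η₀ : ℝ, 0 < η₀ ∧
        ∀ t : ℝ, t ≤ σ₀ → ∀ r : ℝ, R₀ * Real.sqrt (-t) ≤ r → ∀ z : ℝ,
          (∀ s' : ℝ, s' ≤ t → ∀ z' : ℝ,
            circ (fun τ x => v τ (x + Real.sqrt (-τ) • y₀)) ((4 * (B + ‖y₀‖ / 2 + C) + R₀ + 1 + 8 * Real.pi * C / η₀) * Real.sqrt (-s')) z' s' < circ (fun τ x => v τ (x + Real.sqrt (-τ) • y₀)) r z t) →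
          (-t) * vortCirc (fun τ x => v τ (x + Real.sqrt (-τ) • y₀)) r z t ≤ η₀ * r → (-t) * |radVortCirc (fun τ x => v τ (x + Real.sqrt (-τ) • y₀)) r z t| ≤ η₀ * r →
          0 < deriv (fun σ => circ (fun τ x => v τ (x + Real.sqrt (-τ) • y₀)) r z σ) t →
          remainder (fun τ x => v τ (x + Real.sqrt (-τ) • y₀)) r z t ≤ B / Real.sqrt (-t) * (vortCirc (fun τ x => v τ (x + Real.sqrt (-τ) • y₀)) r z t + |radVortCirc (fun τ x => v τ (x + Real.sqrt (-τ) • y₀)) r z t|)) :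
    HemisphereLiouvilleE3 := by
  intro C v hrate hcont hmild hdiv hnn
  have hv : InDoorClass C v := ⟨hrate, hcont, hmild, hdiv⟩
  obtain ⟨y₀, B, hB, R₀, hR₀, σ₀, hσ₀, η₀, hη, hed⟩ := H C v hv hnn
  exact inner_curl_e3_eq_zero_of_movingEddyBound hv hnn y₀ hB hR₀ hσ₀ hη hed

/-- **The CRUX from the moving-frame eddy bound** (every direction `e ≠ 0`: `stub_rotate` ∘ `hemisphereLiouvilleE3_of_movingEddyBound`). -/
theorem circulationCarryingRigidity_of_movingEddyBound
    (H : ∀ (C : ℝ) (v : ℝ → EuclideanSpace ℝ (Fin 3) → EuclideanSpace ℝ (Fin 3)), InDoorClass C v → SignE3 v →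
      ∃ y₀ : EuclideanSpace ℝ (Fin 3), ∃ B : ℝ, 0 ≤ B ∧ ∃ R₀ : ℝ, 0 ≤ R₀ ∧ ∃ σ₀ : ℝ, σ₀ < 0 ∧ ∃ η₀ : ℝ, 0 < η₀ ∧
        ∀ t : ℝ, t ≤ σ₀ → ∀ r : ℝ, R₀ * Real.sqrt (-t) ≤ r → ∀ z : ℝ,
          (∀ s' : ℝ, s' ≤ t → ∀ z' : ℝ,
            circ (fun τ x => v τ (x + Real.sqrt (-τ) • y₀)) ((4 * (B + ‖y₀‖ / 2 + C) + R₀ + 1 + 8 * Real.pi * C / η₀) * Real.sqrt (-s')) z' s' < circ (fun τ x => v τ (x + Real.sqrt (-τ) • y₀)) r z t) →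
          (-t) * vortCirc (fun τ x => v τ (x + Real.sqrt (-τ) • y₀)) r z t ≤ η₀ * r → (-t) * |radVortCirc (fun τ x => v τ (x + Real.sqrt (-τ) • y₀)) r z t| ≤ η₀ * r →
          0 < deriv (fun σ => circ (fun τ x => v τ (x + Real.sqrt (-τ) • y₀)) r z σ) t →
          remainder (fun τ x => v τ (x + Real.sqrt (-τ) • y₀)) r z t ≤ B / Real.sqrt (-t) * (vortCirc (fun τ x => v τ (x + Real.sqrt (-τ) • y₀)) r z t + |radVortCirc (fun τ x => v τ (x + Real.sqrt (-τ) • y₀)) r z t|)) :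
    CirculationCarryingRigidity :=
  stub_rotate (hemisphereLiouvilleE3_of_movingEddyBound H)

end Summit.NavierStokesRegularity.NavierStokesRegularity.Theorems.HalfSpaceWindowDoorCirculationCarryingRigidityMovingLiouville

end
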